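import Summits.KontsevichZagierPeriods.Zeta5Search.TwoTaleP15SecondLineBoundRate
import Summits.KontsevichZagierPeriods.Zeta5Search.TwoTaleP15SecondLineCertificate
import Summits.KontsevichZagierPeriods.Zeta5Search.TwoTaleP15LineBoundDecay

/-!
# P15, second tale: the half-line bound `π ∫ ‖R̂_n(uₙ+iy)‖/cosh(2πy) dy ≤ e^{−cn}` for every `c < 29.10786` (U2-4/6 ⇒ U2-5 input)

HONEST FRAMING: systematic search; no irrationality claim unless certified.  An explicit integral of the modulus of
an explicit rational function is bounded; nothing about `ζ(2)` is asserted.  `DecayT c′` itself needs, in addition,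
fam-measure g5's line representation of `q̂_nζ(2) − p̂_n` (U2-1/2/3) — NOT in this file.

Cell pub-zeta5, P1 g10.  Clone of P1 g9's `TwoTaleP15LineBoundDecay` (tale 1) for the second tale at the Remark-5
partner: with the scaled line bound `log_norm_RCT_partner_line_le` (n·profileT0 + 4 log n + 12 log(484+y²/…)+K0T) and
the kernel-checked certificate `TwoTaleP15SecondLineCertificate.certT_delta` (`profileT0 − (2π−δ)|η| ≤ −29.10786 + 7δ`),
on ANY abscissae `uₙ` with `|uₙ + (897/100)n| ≤ 1` (so fam-measure may put the contour at `Re t ∈ ½ℤ + ¼`, where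
`|π/sin 2πt| = π/cosh 2πy`):
* `lineIntegrandT_le` — pointwise: `‖R̂_n(u+iy)‖/cosh(2πy) ≤ 2e^{K0T} n⁴ (484+y²)¹² e^{nM} e^{−δ|y|}`;
* `integrable_poly_exp12` — the majorant is integrable;
* **`secondTale_halfLineBound`**: for every `c < 29.10786` and every such `u : ℕ → ℝ`,
  `∀ᶠ n, π · ∫ ‖RCT (aT n) (bT n) (uₙ + iy)‖ / cosh(2πy) dy ≤ e^{−cn}`.
So `DecayT c′` for any `c′ < 29.10786` follows from a representation
`|q̂_nζ(2) − p̂_n| ≤ π ∫ ‖R̂_n(uₙ+iy)‖/cosh(2πy) dy` (eventually), which is what U2-1/2/3 are to provide.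
-/

noncomputable section

open Real Complex MeasureTheory Set Filter
open Literature.NumberTheory.Irrationality.Zudilin2014

namespace Summit.KontsevichZagierPeriods.Zeta5Search.TwoTaleLineBound

open TwoTaleP15 (aT bT)
open TwoTaleP15SecondLineProfileShape (profileT0)
open TwoTaleP15SecondLineCertificate (certT_delta)

variable {M δ : ℝ}

/-- **Pointwise bound on the line** (`y ≠ 0`, `n ≥ 4`, `|u + (897/100)n| ≤ 1`), given the certificate with slope `2π − δ`. -/
theorem lineIntegrandT_le (hcert : ∀ η : ℝ, η ≠ 0 → profileT0 (-897 / 100) η - (2 * π - δ) * |η| ≤ M) {n : ℕ}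
    (hn : 4 ≤ n) {u : ℝ} (hu : |u + 897 / 100 * n| ≤ 1) {y : ℝ} (hy : y ≠ 0) :
    ‖RCT (aT n) (bT n) ((u : ℂ) + (y : ℂ) * I)‖ / Real.cosh (2 * π * y) ≤
      2 * Real.exp K0T * (n : ℝ) ^ 4 * (484 + y ^ 2) ^ 12 * Real.exp (n * M) * Real.exp (-(δ * |y|)) := by
  have hn0 : (0 : ℝ) < n := by exact_mod_cast (show 0 < n by omega)
  have hn1 : (1 : ℝ) ≤ n := by exact_mod_cast (show 1 ≤ n by omega)
  obtain ⟨η, hη⟩ : ∃ η : ℝ, η = y / n := ⟨_, rfl⟩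
  have hη0 : η ≠ 0 := by rw [hη]; exact div_ne_zero hy hn0.ne'
  have hyη : (n : ℝ) * η = y := by rw [hη]; field_simp
  have hL := log_norm_RCT_partner_line_le hη0 hn hu
  rw [show ((((n : ℝ) * η : ℝ) : ℂ)) = (y : ℂ) by rw [hyη]] at hL
  have hc := hcert η hη0
  have habs : (n : ℝ) * |η| = |y| := by rw [← abs_of_pos hn0, ← abs_mul, hyη]
  have hc' : (n : ℝ) * profileT0 (-897 / 100) η ≤ n * M + (2 * π - δ) * |y| :=
    calc (n : ℝ) * profileT0 (-897 / 100) η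
        = n * (profileT0 (-897 / 100) η - (2 * π - δ) * |η|) + (2 * π - δ) * (n * |η|) := by ring
      _ ≤ n * M + (2 * π - δ) * (n * |η|) := by gcongr
      _ = n * M + (2 * π - δ) * |y| := by rw [habs]
  have hlog : Real.log (22 ^ 2 + η ^ 2) ≤ Real.log (484 + y ^ 2) := by
    apply Real.log_le_log (by positivity)
    have : η ^ 2 ≤ y ^ 2 := by
      rw [hη, div_pow]; exact div_le_self (sq_nonneg y) (by nlinarith)
    nlinarith
  have hlogR : Real.log ‖RCT (aT n) (bT n) ((u : ℂ) + (y : ℂ) * I)‖ ≤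
      n * M + (2 * π - δ) * |y| + 4 * Real.log n + 12 * Real.log (484 + y ^ 2) + K0T := by
    refine hL.trans ?_
    have h12 := mul_le_mul_of_nonneg_left hlog (by norm_num : (0:ℝ) ≤ 12)
    exact add_le_add (add_le_add (add_le_add hc' le_rfl) h12) le_rfl
  have hR : ‖RCT (aT n) (bT n) ((u : ℂ) + (y : ℂ) * I)‖ ≤
      Real.exp (n * M + (2 * π - δ) * |y| + 4 * Real.log n + 12 * Real.log (484 + y ^ 2) + K0T) := by
    rcases eq_or_lt_of_le (norm_nonneg (RCT (aT n) (bT n) ((u : ℂ) + (y : ℂ) * I))) with h0 | hpos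
    · rw [← h0]; exact (Real.exp_pos _).le
    · exact (Real.log_le_iff_le_exp hpos).1 hlogR
  -- the kernel `1/cosh(2πy) ≤ 2 e^{−2π|y|}`
  have hK : Real.exp (2 * π * |y|) ≤ 2 * Real.cosh (2 * π * y) := by
    have h : Real.exp |2 * π * y| ≤ 2 * Real.cosh (2 * π * y) := by
      rw [Real.cosh_eq]
      rcases le_or_gt 0 (2 * π * y) with h | h
      · rw [abs_of_nonneg h]; linarith [Real.exp_pos (-(2 * π * y))]
      · rw [abs_of_neg h]; linarith [Real.exp_pos (2 * π * y)]
    rwa [abs_mul, abs_of_pos (by positivity : (0:ℝ) < 2 * π)] at h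
  have hcosh : 0 < Real.cosh (2 * π * y) := Real.cosh_pos _
  rw [div_le_iff₀ hcosh]
  have hexp : Real.exp (n * M + (2 * π - δ) * |y| + 4 * Real.log n + 12 * Real.log (484 + y ^ 2) + K0T) =
      Real.exp K0T * (n : ℝ) ^ 4 * (484 + y ^ 2) ^ 12 * Real.exp (n * M) * Real.exp (-(δ * |y|))
        * Real.exp (2 * π * |y|) := by
    rw [show n * M + (2 * π - δ) * |y| + 4 * Real.log n + 12 * Real.log (484 + y ^ 2) + K0T =
      K0T + 4 * Real.log n + 12 * Real.log (484 + y ^ 2) + n * M + (-(δ * |y|)) + 2 * π * |y| by ring]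
    rw [Real.exp_add, Real.exp_add, Real.exp_add, Real.exp_add, Real.exp_add]
    rw [show (4 : ℝ) * Real.log n = Real.log ((n : ℝ) ^ 4) by rw [Real.log_pow]; push_cast; ring,
      Real.exp_log (by positivity),
      show (12 : ℝ) * Real.log (484 + y ^ 2) = Real.log ((484 + y ^ 2) ^ 12) by rw [Real.log_pow]; push_cast; ring,
      Real.exp_log (by positivity)]
  have hpos5 : 0 ≤ Real.exp K0T * (n : ℝ) ^ 4 * (484 + y ^ 2) ^ 12 * Real.exp (n * M) * Real.exp (-(δ * |y|)) := by
    positivity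
  calc ‖RCT (aT n) (bT n) ((u : ℂ) + (y : ℂ) * I)‖
      ≤ Real.exp K0T * (n : ℝ) ^ 4 * (484 + y ^ 2) ^ 12 * Real.exp (n * M) * Real.exp (-(δ * |y|))
          * Real.exp (2 * π * |y|) := by rw [← hexp]; exact hR
    _ ≤ Real.exp K0T * (n : ℝ) ^ 4 * (484 + y ^ 2) ^ 12 * Real.exp (n * M) * Real.exp (-(δ * |y|))
          * (2 * Real.cosh (2 * π * y)) := mul_le_mul_of_nonneg_left hK hpos5
    _ = 2 * Real.exp K0T * (n : ℝ) ^ 4 * (484 + y ^ 2) ^ 12 * Real.exp (n * M) * Real.exp (-(δ * |y|))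
          * Real.cosh (2 * π * y) := by ring

/-! ### The dominating function is integrable -/

/-- `(484 + y²)¹² ≤ (22 + |y|)²⁴`. -/
theorem poly_le_pow12 (y : ℝ) : (484 + y ^ 2) ^ 12 ≤ (22 + |y|) ^ 24 := by
  have h : 484 + y ^ 2 ≤ (22 + |y|) ^ 2 := by nlinarith [abs_nonneg y, sq_abs y]
  calc (484 + y ^ 2) ^ 12 ≤ ((22 + |y|) ^ 2) ^ 12 := pow_le_pow_left₀ (by positivity) h 12
    _ = (22 + |y|) ^ 24 := by ring

/-- `(22 + |y|)²⁴ ≤ 24!·(2/δ)²⁴·e^{(δ/2)(22+|y|)}` (`δ > 0`). -/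
theorem pow_le_exp24 (hδ : 0 < δ) (y : ℝ) :
    (22 + |y|) ^ 24 ≤ (Nat.factorial 24 : ℝ) * (2 / δ) ^ 24 * Real.exp (δ / 2 * (22 + |y|)) := by
  have hx : 0 ≤ δ / 2 * (22 + |y|) := by positivity
  have h := Real.pow_div_factorial_le_exp _ hx 24
  have hf : (0 : ℝ) < Nat.factorial 24 := by exact_mod_cast Nat.factorial_pos 24
  rw [div_le_iff₀ hf] at h
  have e : (22 + |y|) ^ 24 = (2 / δ) ^ 24 * (δ / 2 * (22 + |y|)) ^ 24 := by
    rw [← mul_pow]; congr 1; field_simp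
  rw [e]
  have h2 : 0 ≤ (2 / δ) ^ 24 := by positivity
  nlinarith [h, h2]

/-- The dominating function `(484+y²)¹² e^{−δ|y|}` is integrable (`δ > 0`). -/
theorem integrable_poly_exp12 (hδ : 0 < δ) :
    Integrable (fun y : ℝ => (484 + y ^ 2) ^ 12 * Real.exp (-(δ * |y|))) := by
  set C : ℝ := (Nat.factorial 24 : ℝ) * (2 / δ) ^ 24 * Real.exp (11 * δ) with hC
  have hdom : ∀ y : ℝ, (484 + y ^ 2) ^ 12 * Real.exp (-(δ * |y|)) ≤ C * Real.exp (-(δ / 2 * |y|)) := by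
    intro y
    have h1 := (poly_le_pow12 y).trans (pow_le_exp24 hδ y)
    have he : (Nat.factorial 24 : ℝ) * (2 / δ) ^ 24 * Real.exp (δ / 2 * (22 + |y|)) * Real.exp (-(δ * |y|)) =
        C * Real.exp (-(δ / 2 * |y|)) := by
      rw [hC, mul_assoc, ← Real.exp_add, mul_assoc ((Nat.factorial 24 : ℝ) * (2 / δ) ^ 24), ← Real.exp_add]
      congr 2; ring
    rw [← he]
    exact mul_le_mul_of_nonneg_right h1 (Real.exp_pos _).le
  refine Integrable.mono' ((integrable_exp_neg_mul_abs (by positivity : 0 < δ / 2)).const_mul C) ?_ ?_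
  · exact (by fun_prop : Continuous fun y : ℝ => (484 + y ^ 2) ^ 12 * Real.exp (-(δ * |y|))).aestronglyMeasurable
  · refine Filter.Eventually.of_forall fun y => ?_
    rw [Real.norm_eq_abs, abs_of_nonneg (by positivity)]
    exact hdom y

/-! ### The half-line bound -/

/-- The integral of the majorant: `∫ ‖R̂_n‖/cosh(2πy) ≤ 2e^{K0T} n⁴ e^{nM} · ∫ (484+y²)¹²e^{−δ|y|}`. -/
theorem integral_lineIntegrandT_le (hδ : 0 < δ)
    (hcert : ∀ η : ℝ, η ≠ 0 → profileT0 (-897 / 100) η - (2 * π - δ) * |η| ≤ M) {n : ℕ} (hn : 4 ≤ n)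
    {u : ℝ} (hu : |u + 897 / 100 * n| ≤ 1) :
    ∫ y : ℝ, ‖RCT (aT n) (bT n) ((u : ℂ) + (y : ℂ) * I)‖ / Real.cosh (2 * π * y) ≤
      2 * Real.exp K0T * (n : ℝ) ^ 4 * Real.exp (n * M) * ∫ y : ℝ, (484 + y ^ 2) ^ 12 * Real.exp (-(δ * |y|)) := by
  rw [← integral_const_mul]
  refine integral_mono_of_nonneg (Filter.Eventually.of_forall fun y => by
      have := Real.cosh_pos (2 * π * y); positivity)
    ((integrable_poly_exp12 hδ).const_mul _) ?_
  have h0 : ∀ᵐ y : ℝ ∂volume, y ≠ 0 := by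
    have : (volume : Measure ℝ) {0} = 0 := measure_singleton 0
    filter_upwards [measure_eq_zero_iff_ae_notMem.1 this] with y hy
    simpa using hy
  filter_upwards [h0] with y hy
  have := lineIntegrandT_le hcert hn hu hy
  calc ‖RCT (aT n) (bT n) ((u : ℂ) + (y : ℂ) * I)‖ / Real.cosh (2 * π * y)
      ≤ 2 * Real.exp K0T * (n : ℝ) ^ 4 * (484 + y ^ 2) ^ 12 * Real.exp (n * M) * Real.exp (-(δ * |y|)) := this
    _ = 2 * Real.exp K0T * (n : ℝ) ^ 4 * Real.exp (n * M) * ((484 + y ^ 2) ^ 12 * Real.exp (-(δ * |y|))) := by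
        ring

/-- `n⁴ ≤ (384/ε⁴)·e^{εn/2}` (`ε > 0`). -/
theorem pow_four_le_exp {ε : ℝ} (hε : 0 < ε) (n : ℕ) : (n : ℝ) ^ 4 ≤ 384 / ε ^ 4 * Real.exp (ε / 2 * n) := by
  have hx : 0 ≤ ε / 2 * n := by positivity
  have h := Real.pow_div_factorial_le_exp _ hx 4
  have hf : (Nat.factorial 4 : ℝ) = 24 := by norm_num [Nat.factorial]
  rw [hf, div_le_iff₀ (by norm_num : (0:ℝ) < 24)] at h
  have hε4 : 0 < ε ^ 4 := by positivity
  rw [div_mul_eq_mul_div, le_div_iff₀ hε4]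
  have e : (ε / 2 * n) ^ 4 = ε ^ 4 * (n : ℝ) ^ 4 / 16 := by ring
  rw [e] at h
  nlinarith [h]

/-- **The second-tale half-line bound (U2-4 + U2-6 assembled):** for every `c < 29.10786` and every choice of
abscissae `uₙ` with `|uₙ + (897/100)n| ≤ 1`, eventually
`π · ∫ ‖R̂_n(uₙ + iy)‖ / cosh(2πy) dy ≤ e^{−cn}`. -/
theorem secondTale_halfLineBound {c : ℝ} (hc : c < 29.10786) (u : ℕ → ℝ)
    (hu : ∀ n : ℕ, |u n + 897 / 100 * n| ≤ 1) :
    ∀ᶠ n : ℕ in atTop, π * ∫ y : ℝ, ‖RCT (aT n) (bT n) ((u n : ℂ) + (y : ℂ) * I)‖ / Real.cosh (2 * π * y)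
      ≤ Real.exp (-(c * n)) := by
  -- choose the slack δ and the gap ε
  set δ : ℝ := min 3 ((29.10786 - c) / 14) with hδdef
  have hδ0 : 0 < δ := lt_min (by norm_num) (by linarith)
  have hδ3 : δ ≤ 3 := min_le_left _ _
  have hδc : 7 * δ ≤ (29.10786 - c) / 2 := by
    have := min_le_right 3 ((29.10786 - c) / 14); linarith
  set M : ℝ := -29.10786 + 7 * δ with hMdef
  have hcert : ∀ η : ℝ, η ≠ 0 → profileT0 (-897 / 100) η - (2 * π - δ) * |η| ≤ M :=
    fun η hη => certT_delta hδ0.le hδ3 η hη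
  set ε : ℝ := -M - c with hεdef
  have hε : 0 < ε := by rw [hεdef, hMdef]; linarith
  set A : ℝ := 2 * Real.exp K0T * ∫ y : ℝ, (484 + y ^ 2) ^ 12 * Real.exp (-(δ * |y|)) with hA
  have hA0 : 0 ≤ A := by
    rw [hA]; exact mul_nonneg (by positivity) (integral_nonneg fun y => by positivity)
  have hev : ∀ᶠ n : ℕ in atTop, π * A * (384 / ε ^ 4) ≤ Real.exp (ε / 2 * n) := by
    have ht : Tendsto (fun n : ℕ => Real.exp (ε / 2 * n)) atTop atTop :=
      Real.tendsto_exp_atTop.comp (tendsto_natCast_atTop_atTop.const_mul_atTop (by positivity))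
    exact ht.eventually_ge_atTop _
  filter_upwards [hev, Filter.eventually_ge_atTop 4] with n hK hn4
  have hI := integral_lineIntegrandT_le hδ0 hcert hn4 (hu n)
  have hsq := pow_four_le_exp hε n
  calc π * ∫ y : ℝ, ‖RCT (aT n) (bT n) ((u n : ℂ) + (y : ℂ) * I)‖ / Real.cosh (2 * π * y)
      ≤ π * (2 * Real.exp K0T * (n : ℝ) ^ 4 * Real.exp (n * M) *
          ∫ y : ℝ, (484 + y ^ 2) ^ 12 * Real.exp (-(δ * |y|))) := mul_le_mul_of_nonneg_left hI Real.pi_pos.le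
    _ = π * A * (n : ℝ) ^ 4 * Real.exp (n * M) := by rw [hA]; ring
    _ ≤ π * A * (384 / ε ^ 4 * Real.exp (ε / 2 * n)) * Real.exp (n * M) := by gcongr
    _ = (π * A * (384 / ε ^ 4)) * Real.exp (ε / 2 * n) * Real.exp (n * M) := by ring
    _ ≤ Real.exp (ε / 2 * n) * Real.exp (ε / 2 * n) * Real.exp (n * M) := by gcongr
    _ = Real.exp (-(c * n)) := by
        rw [← Real.exp_add, ← Real.exp_add]; congr 1; rw [hεdef]; ring

end Summit.KontsevichZagierPeriods.Zeta5Search.TwoTaleLineBound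

end
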